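import Literature.Analysis.FluidPDE.DriftHeatOscillation
import Literature.Analysis.FluidPDE.ParabolicLocalEstimates
import HarnessLib

/-!
# A two-point Harnack inequality with explicit time lag for `uₜ + a·∇u − Δu = 0`, from
# Lieberman's local maximum principle and weak Harnack inequality; oscillation decay and chains

Analysis/FluidPDE proofs-and-glue file on the path from the named facts
`Literature.Analysis.FluidPDE.Lieberman1996_local_max` (Lieberman 1996, Theorem 6.17) and
`Literature.Analysis.FluidPDE.Lieberman1996_weak_harnack` (Corollary 6.24) to KNSS 2009,
Lemma 2.1 (`KNSS2009_lemma21`). It proves, for the elementary time-integrated class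
(`IsDriftHeatSolutionOn a u A (0,T] Ω` of `DriftHeatLocalClass`):

* `exists_twoPointHarnack` — **the pointwise Harnack inequality with a time lag** ("From
  Theorems 6.17 and 6.18, we also conclude a parabolic analog of Harnack's inequality",
  Lieberman p. 127, here with the flexible cylinders of Corollary 6.24): for every drift bound
  `A`, `R₀ > 0` and lag parameter `0 < γ ≤ 1` there is `C ≥ 1` such that a nonnegative
  solution on `Q((y,s),4R) = B(y,4R) × (s − 16R², s)` (`R ≤ R₀`, inside `Ω × (0,T]`) satisfies
  `u(t₁,x₁) ≤ C u(t₂,x₂)` whenever `x₁, x₂ ∈ B(y,R)`, `t₁, t₂ ∈ (s − R², s)` and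
  `t₂ − t₁ ≥ γR²`. Proof: the local maximum principle on the cylinder `Q((x₁, t₁ + γR²/8), r)`,
  `r = √γ R/2`, bounds `u(t₁,x₁)` by `C_L r^{−n−2} ∫_{Q((x₁,t₁+γR²/8), 2r)} u + C_L k r`, and the
  weak Harnack inequality with `Y₂ = (x₁, t₁ + γR²/8)`, `θ₂ = √γ`, `Y₁ = (x₂, t₂ + ν)`,
  `θ₁ = θ₃ = γ/4`, `θ₄ = 1` (gap `t₂ + ν − γR²/2 > t₁ + γR²/8`) bounds the same integral by
  `C_W R^{n+2}(u(t₂,x₂) + kR)`; as `k → 0`, `C = C_L C_W (2/√γ)^{n+2}`. The matrix of this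
  statement is named `IsTwoPointHarnackConst E A R₀ γ C`.
* `IsTwoPointHarnackConst.osc_step`, `.osc_iterate` — **oscillation decay** on the top-aligned
  regions `B(x, ρ/8ʲ) × (s' − (ρ/8ʲ)²/4, s')` by the factor `1 − 1/C` per level (Lieberman,
  proof of Theorem 6.28, with `γ = 1/2`);
* `IsTwoPointHarnackConst.chain` — **Harnack chains**: `w(σ₀,Z₀) ≤ Cⁿ w(σₙ,Zₙ)` along points
  `|Zᵢ₊₁ − Zᵢ| < R` and times with lags `≥ γR²` inside cylinders topped below `T`.

(The earlier `DriftHeatOscillation` drew the same consequences from the fact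
`Lieberman1996_harnack_drift`, whose adjacent-cylinder geometry is false —
`not_Lieberman1996_harnack_drift_real`; this file supersedes it.)

## References

* G. M. Lieberman, *Second Order Parabolic Differential Equations*, World Scientific (1996),
  Ch. VI §6 Theorem 6.17, Corollary 6.24; §7 Theorems 6.25 (chaining), 6.27, 6.28.
  [Lieberman1996]
-/

noncomputable section

open MeasureTheory Set Function Metric InnerProductSpace
open scoped Laplacian

namespace Literature.Analysis.FluidPDE

section TwoPoint

variable (E : Type*) [NormedAddCommGroup E] [InnerProductSpace ℝ E] [FiniteDimensional ℝ E]
  [MeasurableSpace E] [BorelSpace E]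

/-- **"`C` is a two-point Harnack constant for drift bound `A`, radii `≤ R₀` and lag `γ`"**:
for every open `Ω`, jointly measurable drift with `‖a‖ ≤ A` on `(0,T] × Ω`, every `u` in the
elementary class of `KNSS2009_lemma21` on `(0,T] × Ω`, every cylinder `Q((y,s),4R)`
(`0 < R ≤ R₀`, `B̄(y,4R) ⊆ Ω`, `16R² < s ≤ T`) on which `u ≥ 0`, and all `x₁, x₂ ∈ B(y,R)`,
`t₁, t₂ ∈ (s − R², s)` with `t₂ − t₁ ≥ γR²`: `u(t₁,x₁) ≤ C u(t₂,x₂)` (the parabolic Harnack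
inequality of Moser; Lieberman 1996, Theorem 6.27 with the cylinders of Corollary 6.24).
[cite: Lieberman1996, Ch. VI Thm 6.27 with Cor 6.24] -/
def IsTwoPointHarnackConst (A R₀ γ C : ℝ) : Prop :=
  ∀ ⦃Ω : Set E⦄ ⦃T : ℝ⦄ ⦃a : ℝ → E → E⦄ ⦃u : ℝ → E → ℝ⦄,
    IsOpen Ω →
    Measurable (uncurry a) → (∀ t ∈ Ioc 0 T, ∀ x ∈ Ω, ‖a t x‖ ≤ A) →
    (∀ t ∈ Ioc 0 T, ContDiffOn ℝ 2 (u t) Ω) →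
    ContinuousOn (fun p : ℝ × E => fderiv ℝ (u p.1) p.2) (Ioc 0 T ×ˢ Ω) →
    ContinuousOn (fun p : ℝ × E => (Δ (u p.1)) p.2) (Ioc 0 T ×ˢ Ω) →
    (∀ x ∈ Ω, ∀ s t : ℝ, 0 < s → s ≤ t → t ≤ T →
      u t x - u s x = ∫ r in s..t, ((Δ (u r)) x - fderiv ℝ (u r) x (a r x))) →
    ∀ ⦃y : E⦄ ⦃s R : ℝ⦄, 0 < R → R ≤ R₀ → closedBall y (4 * R) ⊆ Ω →
      16 * R ^ 2 < s → s ≤ T →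
      (∀ t ∈ Ioo (s - 16 * R ^ 2) s, ∀ x ∈ ball y (4 * R), 0 ≤ u t x) →
      ∀ ⦃t₁ : ℝ⦄ ⦃x₁ : E⦄ ⦃t₂ : ℝ⦄ ⦃x₂ : E⦄,
        t₁ ∈ Ioo (s - R ^ 2) s → x₁ ∈ ball y R → t₂ ∈ Ioo (s - R ^ 2) s → x₂ ∈ ball y R →
        γ * R ^ 2 ≤ t₂ - t₁ → u t₁ x₁ ≤ C * u t₂ x₂

variable {E}

/-- **The two-point Harnack inequality with time lag `γR²`, from Lieberman's Theorem 6.17 and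
Corollary 6.24** (see the module docstring for the choice of cylinders; the constant is
`max 1 (C_L C_W (2/√γ)^{n+2})`). [cite: Lieberman1996, Ch. VI Thm 6.27 with Thm 6.17, Cor 6.24] -/
theorem exists_twoPointHarnack (hLM : Lieberman1996_local_max E)
    (hWH : Lieberman1996_weak_harnack E) (A : ℝ) {R₀ γ : ℝ} (hR₀ : 0 < R₀) (hγ : 0 < γ)
    (hγ1 : γ ≤ 1) : ∃ C : ℝ, 1 ≤ C ∧ IsTwoPointHarnackConst E A R₀ γ C := by
  obtain ⟨CL, hCL0, hL⟩ := @hLM A R₀ hR₀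
  have hθ : 0 < γ / 4 := by positivity
  have hsγ : 0 < Real.sqrt γ := Real.sqrt_pos.2 hγ
  obtain ⟨CW, hCW0, hW⟩ :=
    @hWH A R₀ (γ / 4) (Real.sqrt γ) (γ / 4) 1 hR₀ hθ hsγ hθ one_pos (by linarith)
  obtain ⟨n, hn⟩ : ∃ n : ℕ, n = Module.finrank ℝ E := ⟨_, rfl⟩
  obtain ⟨κ, hκ⟩ : ∃ κ : ℝ, κ = (2 / Real.sqrt γ) ^ (n + 2) := ⟨_, rfl⟩
  have hκ0 : 0 < κ := by rw [hκ]; positivity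
  refine ⟨max 1 (CL * CW * κ), le_max_left _ _, ?_⟩
  intro Ω T a u hΩ ham haA hu2 hDu hΔu hequ y s R hR hRR₀ hB hs hsT hpos t₁ x₁ t₂ x₂ ht₁ hx₁ ht₂ hx₂
    hlag
  have hR2 : 0 < R ^ 2 := by positivity
  have hsγ1 : Real.sqrt γ ≤ 1 := by rw [← Real.sqrt_one]; exact Real.sqrt_le_sqrt hγ1
  have hsγsq : Real.sqrt γ ^ 2 = γ := Real.sq_sqrt hγ.le
  have hγ2 : γ ^ 2 ≤ γ := by nlinarith
  have hγR2 : 0 < γ * R ^ 2 := by positivity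
  have hγR2' : γ * R ^ 2 ≤ R ^ 2 := by nlinarith
  have hγ2R2 : 0 < γ ^ 2 * R ^ 2 := by positivity
  -- the small cylinder `Q((x₁, τ₁), r)` around `(x₁, t₁)`
  obtain ⟨r, hr⟩ : ∃ r : ℝ, r = Real.sqrt γ * R / 2 := ⟨_, rfl⟩
  have hrpos : 0 < r := by rw [hr]; positivity
  have h2r : 2 * r = Real.sqrt γ * R := by rw [hr]; ring
  have h2r_le : 2 * r ≤ R := by rw [h2r]; nlinarith
  have hr2 : r ^ 2 = γ * R ^ 2 / 4 := by
    rw [hr, div_pow, mul_pow, hsγsq]; ring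
  have h4r2 : (2 * r) ^ 2 = γ * R ^ 2 := by rw [h2r, mul_pow, hsγsq]
  obtain ⟨τ₁, hτ₁⟩ : ∃ τ₁ : ℝ, τ₁ = t₁ + γ * R ^ 2 / 8 := ⟨_, rfl⟩
  have hx₁y : dist x₁ y < R := mem_ball.1 hx₁
  have hx₂y : dist x₂ y < R := mem_ball.1 hx₂
  have hτ₁t₁ : t₁ < τ₁ := by rw [hτ₁]; linarith only [hγR2]
  have hτ₁t₂ : τ₁ + γ * R ^ 2 / 2 < t₂ := by rw [hτ₁]; linarith only [hlag, hγR2]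
  have hτ₁s : τ₁ < s := by linarith only [hτ₁t₂, ht₂.2, hγR2]
  have ht₁s : s - R ^ 2 < t₁ := ht₁.1
  -- `u ≥ 0` on `Q((y,s),4R)` gives `u⁺ = u` on the integration cylinder
  set S : Set (ℝ × E) := Ioo (τ₁ - (2 * r) ^ 2) τ₁ ×ˢ ball x₁ (2 * r) with hS
  have hSsub : ∀ p ∈ S, p.1 ∈ Ioo (s - 16 * R ^ 2) s ∧ p.2 ∈ ball y (4 * R) := by
    rintro ⟨q, z⟩ ⟨hq, hz⟩
    rw [h4r2] at hq
    refine ⟨⟨by linarith only [hq.1, ht₁s, hτ₁t₁, hγR2', hR2], by linarith only [hq.2, hτ₁s]⟩, ?_⟩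
    rw [mem_ball] at hz ⊢
    calc dist z y ≤ dist z x₁ + dist x₁ y := dist_triangle _ _ _
      _ < 2 * r + R := add_lt_add hz hx₁y
      _ ≤ 4 * R := by linarith only [h2r_le, hR]
  have hint_eq : (∫ p in S, max (u p.1 p.2) 0) = ∫ p in S, u p.1 p.2 := by
    refine setIntegral_congr_fun (measurableSet_Ioo.prod measurableSet_ball) fun p hp => ?_
    obtain ⟨hq, hz⟩ := hSsub p hp
    exact max_eq_left (hpos p.1 hq p.2 hz)
  -- auxiliary inequalities for the cylinder inclusions
  have hsq₁ : ((γ / 4 + γ / 4) * R) ^ 2 ≤ R ^ 2 / 4 := by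
    have h0 : 0 ≤ γ / 2 := by positivity
    have h1 : γ / 2 ≤ 1 / 2 := by linarith only [hγ1]
    calc ((γ / 4 + γ / 4) * R) ^ 2 = (γ / 2) ^ 2 * R ^ 2 := by ring
      _ ≤ (1 / 2) ^ 2 * R ^ 2 := by gcongr
      _ = R ^ 2 / 4 := by ring
  have hsq₂ : ((Real.sqrt γ + 1) * R) ^ 2 ≤ 4 * R ^ 2 := by
    have h0 : 0 ≤ Real.sqrt γ + 1 := by positivity
    have h1 : Real.sqrt γ + 1 ≤ 2 := by linarith only [hsγ1]
    calc ((Real.sqrt γ + 1) * R) ^ 2 = (Real.sqrt γ + 1) ^ 2 * R ^ 2 := by ring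
      _ ≤ 2 ^ 2 * R ^ 2 := by gcongr
      _ = 4 * R ^ 2 := by ring
  have hθsq : (γ / 4 * R) ^ 2 = γ ^ 2 * R ^ 2 / 16 := by ring
  -- for every `k > 0`: local maximum principle, then weak Harnack
  have hmain : ∀ k : ℝ, 0 < k → u t₁ x₁ ≤ CL * CW * κ * u t₂ x₂ + k * (CL * (κ * CW * R + r)) := by
    intro k hk
    -- Theorem 6.17 on `Q((x₁, τ₁), 2r)`
    have hBL : closedBall x₁ (2 * r) ⊆ Ω := by
      refine (closedBall_subset_closedBall' ?_).trans hB
      linarith only [hx₁y.le, h2r_le, hR]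
    have h1 := hL hΩ ham haA hu2 hDu hΔu hequ (y := x₁) (s := τ₁) hrpos
      (by linarith only [h2r_le, hRR₀, hrpos] : r ≤ R₀) hk hBL
      (by linarith only [hr2, hγR2', ht₁s, hτ₁t₁, hs, hR2] : 4 * r ^ 2 < τ₁)
      (by linarith only [hτ₁s, hsT] : τ₁ ≤ T)
      (t := t₁) (x := x₁) ⟨by linarith only [hr2, hτ₁, hγR2], hτ₁t₁⟩
      (mem_ball_self hrpos)
    rw [hint_eq, ← hn] at h1
    -- Corollary 6.24 with `Y₂ = (x₁, τ₁)`, `Y₁ = (x₂, t₂ + ν)`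
    obtain ⟨ν, hν⟩ : ∃ ν : ℝ, ν = min ((s - t₂) / 2) (γ ^ 2 * R ^ 2 / 32) := ⟨_, rfl⟩
    have hν0 : 0 < ν := by rw [hν]; exact lt_min (by linarith only [ht₂.2]) (by positivity)
    have hν1 : ν ≤ (s - t₂) / 2 := by rw [hν]; exact min_le_left _ _
    have hν2 : ν ≤ γ ^ 2 * R ^ 2 / 32 := by rw [hν]; exact min_le_right _ _
    have h2 := hW hΩ ham haA hu2 hDu hΔu hequ (y₀ := y) (s₀ := s) hR hRR₀ hk hB hs hsT hpos
      (y₁ := x₂) (s₁ := t₂ + ν) (y₂ := x₁) (s₂ := τ₁)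
      (ball_subset_ball (by linarith only [hR]) hx₂)
      ⟨by linarith only [ht₂.1, hν0, hR2], by linarith only [hν1, ht₂.2]⟩
      (ball_subset_ball (by linarith only [hR]) hx₁)
      ⟨by linarith only [ht₁s, hτ₁t₁, hR2], hτ₁s⟩
      (by linarith only [hτ₁t₂, hν0])
      (ball_subset_ball' (by nlinarith only [hx₂y, hγ1, hR, hγ]))
      (by linarith only [ht₂.1, hν0, hsq₁, hR2])
      (ball_subset_ball' (by nlinarith only [hx₁y, hsγ1, hR, hsγ]))
      (by linarith only [ht₁s, hτ₁t₁, hsq₂, hR2])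
      (t := t₂) (x := x₂) ⟨by linarith only [hθsq, hν2, hγ2R2], by linarith only [hν0]⟩
      (mem_ball_self (by positivity))
    -- the two integration cylinders coincide
    have hset : Ioo (τ₁ - (Real.sqrt γ * R) ^ 2) τ₁ ×ˢ ball x₁ (Real.sqrt γ * R) = S := by
      rw [hS, h2r]
    rw [hset, ← hn] at h2
    -- combine
    set I : ℝ := ∫ p in S, u p.1 p.2 with hI
    have hRn : R ^ (n + 2) ≠ 0 := pow_ne_zero _ hR.ne'
    have hrn0 : r ^ (n + 2) ≠ 0 := pow_ne_zero _ hrpos.ne'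
    have hrn : (r ^ (n + 2))⁻¹ = κ * (R ^ (n + 2))⁻¹ := by
      have h3 : r * (2 / Real.sqrt γ) = R := by rw [hr]; field_simp
      have h4 : r ^ (n + 2) * κ = R ^ (n + 2) := by rw [hκ, ← mul_pow, h3]
      have h5 : (r ^ (n + 2))⁻¹ * R ^ (n + 2) = κ := by
        rw [← h4, ← mul_assoc, inv_mul_cancel₀ hrn0, one_mul]
      calc (r ^ (n + 2))⁻¹ = (r ^ (n + 2))⁻¹ * R ^ (n + 2) * (R ^ (n + 2))⁻¹ := by
            rw [mul_assoc, mul_inv_cancel₀ hRn, mul_one]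
        _ = κ * (R ^ (n + 2))⁻¹ := by rw [h5]
    calc u t₁ x₁ ≤ CL * ((r ^ (n + 2))⁻¹ * I + k * r) := h1
      _ = CL * (κ * ((R ^ (n + 2))⁻¹ * I)) + k * (CL * r) := by rw [hrn]; ring
      _ ≤ CL * (κ * (CW * (u t₂ x₂ + k * R))) + k * (CL * r) := by
          gcongr
      _ = CL * CW * κ * u t₂ x₂ + k * (CL * (κ * CW * R + r)) := by ring
  -- let `k → 0`
  have hu₂ : 0 ≤ u t₂ x₂ :=
    hpos t₂ ⟨by linarith only [ht₂.1, hR2], ht₂.2⟩ x₂ (ball_subset_ball (by linarith only [hR]) hx₂)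
  have hD : 0 ≤ CL * (κ * CW * R + r) := by positivity
  have hlim : u t₁ x₁ ≤ CL * CW * κ * u t₂ x₂ := by
    refine le_of_forall_pos_le_add fun ε hε => ?_
    have h1 := hmain (ε / (CL * (κ * CW * R + r) + 1)) (by positivity)
    have h2 : ε / (CL * (κ * CW * R + r) + 1) * (CL * (κ * CW * R + r)) ≤ ε := by
      rw [div_mul_eq_mul_div, div_le_iff₀ (by positivity)]
      nlinarith only [hD, hε]
    linarith only [h1, h2]
  calc u t₁ x₁ ≤ CL * CW * κ * u t₂ x₂ := hlim
    _ ≤ max 1 (CL * CW * κ) * u t₂ x₂ := mul_le_mul_of_nonneg_right (le_max_right _ _) hu₂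

end TwoPoint

section Consequences

variable {E : Type*} [NormedAddCommGroup E] [InnerProductSpace ℝ E] [FiniteDimensional ℝ E]
  [MeasurableSpace E]

variable {A R₀ γ C : ℝ} {Ω : Set E} {T : ℝ} {a : ℝ → E → E} {w : ℝ → E → ℝ}

/-- **The two-point Harnack inequality for a member of the local class** (unpacking
`IsTwoPointHarnackConst`). [cite: Lieberman1996, Ch. VI Thm 6.27 with Cor 6.24] -/
theorem IsTwoPointHarnackConst.apply (hC : IsTwoPointHarnackConst E A R₀ γ C) (hΩ : IsOpen Ω)
    (hw : IsDriftHeatSolutionOn a w A (Ioc 0 T) Ω) {y : E} {s R : ℝ} (hR : 0 < R)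
    (hRR₀ : R ≤ R₀) (hB : closedBall y (4 * R) ⊆ Ω) (hs : 16 * R ^ 2 < s) (hsT : s ≤ T)
    (hpos : ∀ t ∈ Ioo (s - 16 * R ^ 2) s, ∀ x ∈ ball y (4 * R), 0 ≤ w t x)
    {t₁ : ℝ} {x₁ : E} {t₂ : ℝ} {x₂ : E} (ht₁ : t₁ ∈ Ioo (s - R ^ 2) s) (hx₁ : x₁ ∈ ball y R)
    (ht₂ : t₂ ∈ Ioo (s - R ^ 2) s) (hx₂ : x₂ ∈ ball y R) (hlag : γ * R ^ 2 ≤ t₂ - t₁) :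
    w t₁ x₁ ≤ C * w t₂ x₂ :=
  hC hΩ hw.measurable_drift hw.norm_drift_le hw.contDiffOn hw.continuousOn_fderiv
    hw.continuousOn_laplacian hw.integral_eq_Ioc hR hRR₀ hB hs hsT hpos ht₁ hx₁ ht₂ hx₂ hlag

/-! ### Oscillation decay on top-aligned regions -/

/-- **Oscillation decay, one step** (Lieberman 1996, proof of Theorem 6.28, run with the
two-point Harnack inequality of lag `r²/2`): if `m₄ ≤ w ≤ M₄` on `Q((x,s'),4r)` (`B̄(x,4r) ⊆ Ω`,
`16r² < s' ≤ T`, `r ≤ R₀`), then on the top region `B(x,r) × (s' − r²/4, s')` the oscillation of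
`w` is at most `(1 − 1/C)(M₄ − m₄)`: apply Harnack to `M₄ − w` and `w − m₄` between the point
`(x, s' − 3r²/4)` and the points of the top region (lag `> r²/2`). [cite: Lieberman1996, Ch. VI Thm 6.28 (proof)] -/
theorem IsTwoPointHarnackConst.osc_step (hC : IsTwoPointHarnackConst E A R₀ (1 / 2) C)
    (hC1 : 1 ≤ C) (hΩ : IsOpen Ω) (hw : IsDriftHeatSolutionOn a w A (Ioc 0 T) Ω) {x : E}
    {s' r m₄ M₄ : ℝ} (hr : 0 < r) (hrR₀ : r ≤ R₀) (hB : closedBall x (4 * r) ⊆ Ω)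
    (hs : 16 * r ^ 2 < s') (hsT : s' ≤ T)
    (hbd : ∀ t ∈ Ioo (s' - 16 * r ^ 2) s', ∀ z ∈ ball x (4 * r), m₄ ≤ w t z ∧ w t z ≤ M₄)
    {t : ℝ} {z : E} {t' : ℝ} {z' : E} (ht : t ∈ Ioo (s' - r ^ 2 / 4) s') (hz : z ∈ ball x r)
    (ht' : t' ∈ Ioo (s' - r ^ 2 / 4) s') (hz' : z' ∈ ball x r) :
    w t z - w t' z' ≤ (1 - 1 / C) * (M₄ - m₄) := by
  have hCpos : 0 < C := by linarith
  have hr2 : 0 < r ^ 2 := by positivity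
  -- the two nonnegative solutions `M₄ − w` and `w − m₄`
  have hw₁ : IsDriftHeatSolutionOn a (fun t z => -w t z + M₄) A (Ioc 0 T) Ω :=
    hw.neg.add_const hΩ ordConnected_Ioc M₄
  have hw₂ : IsDriftHeatSolutionOn a (fun t z => w t z + -m₄) A (Ioc 0 T) Ω :=
    hw.add_const hΩ ordConnected_Ioc (-m₄)
  have hpos₁ : ∀ t ∈ Ioo (s' - 16 * r ^ 2) s', ∀ z ∈ ball x (4 * r), 0 ≤ -w t z + M₄ :=
    fun t ht z hz => by linarith [(hbd t ht z hz).2]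
  have hpos₂ : ∀ t ∈ Ioo (s' - 16 * r ^ 2) s', ∀ z ∈ ball x (4 * r), 0 ≤ w t z + -m₄ :=
    fun t ht z hz => by linarith [(hbd t ht z hz).1]
  -- the reference point `(x, s' − 3r²/4)` and the top region, inside `Q((x,s'), r)`
  have ht₁ : s' - 3 / 4 * r ^ 2 ∈ Ioo (s' - r ^ 2) s' := by constructor <;> nlinarith
  have hx₁ : x ∈ ball x r := mem_ball_self hr
  have htQ : t ∈ Ioo (s' - r ^ 2) s' := ⟨by nlinarith [ht.1], ht.2⟩
  have ht'Q : t' ∈ Ioo (s' - r ^ 2) s' := ⟨by nlinarith [ht'.1], ht'.2⟩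
  have hlag : 1 / 2 * r ^ 2 ≤ t - (s' - 3 / 4 * r ^ 2) := by nlinarith [ht.1]
  have hlag' : 1 / 2 * r ^ 2 ≤ t' - (s' - 3 / 4 * r ^ 2) := by nlinarith [ht'.1]
  have h1 := hC.apply hΩ hw₁ hr hrR₀ hB hs hsT hpos₁ ht₁ hx₁ htQ hz hlag
  have h2 := hC.apply hΩ hw₂ hr hrR₀ hB hs hsT hpos₂ ht₁ hx₁ ht'Q hz' hlag'
  -- combine
  have key : C * (w t z - w t' z') ≤ (C - 1) * (M₄ - m₄) := by nlinarith [h1, h2]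
  have hθ : (1 - 1 / C) * (M₄ - m₄) = (C - 1) * (M₄ - m₄) / C := by
    field_simp
  rw [hθ, le_div_iff₀ hCpos]
  linarith [key]

omit [InnerProductSpace ℝ E] [FiniteDimensional ℝ E] [MeasurableSpace E] in
/-- A top-aligned region `B(x, ρ) × (s' − ρ²/4, s')` with `B̄(x, ρ) ⊆ Ω`, `ρ² < 4s'`, `s' ≤ T`
lies in `(0, T] × Ω`. [folklore] -/
theorem topRegion_mem {x : E} {s' ρ : ℝ} (hB : closedBall x ρ ⊆ Ω) (hs : ρ ^ 2 < 4 * s')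
    (hsT : s' ≤ T) {t : ℝ} {z : E} (ht : t ∈ Ioo (s' - ρ ^ 2 / 4) s') (hz : z ∈ ball x ρ) :
    t ∈ Ioc (0 : ℝ) T ∧ z ∈ Ω :=
  ⟨⟨by linarith [ht.1], ht.2.le.trans hsT⟩, hB (ball_subset_closedBall hz)⟩

/-- **Oscillation decay, iterated** (Lieberman 1996, Theorem 6.28, for solutions of
`wₜ + a·∇w − Δw = 0` with `m ≤ w ≤ M` on `(0,T] × Ω`): on the top-aligned regions
`B(x, ρ/8ʲ) × (s' − (ρ/8ʲ)²/4, s')`, `B̄(x, ρ) ⊆ Ω`, `ρ² < s' ≤ T`, `ρ ≤ R₀`, the oscillation of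
`w` is at most `(1 − 1/C)ʲ (M − m)` — a modulus of continuity backwards in time from every
point, up to the final time `T`, uniform over the class (the interior regularity that KNSS 2009
take from [LSU] in the proof of Lemma 2.1). [cite: Lieberman1996, Ch. VI Thm 6.28] -/
theorem IsTwoPointHarnackConst.osc_iterate (hC : IsTwoPointHarnackConst E A R₀ (1 / 2) C)
    (hC1 : 1 ≤ C) (hΩ : IsOpen Ω) (hw : IsDriftHeatSolutionOn a w A (Ioc 0 T) Ω) {m M : ℝ}
    (hbd : ∀ t ∈ Ioc 0 T, ∀ z ∈ Ω, m ≤ w t z ∧ w t z ≤ M) {x : E} {s' ρ : ℝ} (hρ : 0 < ρ)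
    (hρR₀ : ρ ≤ R₀) (hB : closedBall x ρ ⊆ Ω) (hs : ρ ^ 2 < s') (hsT : s' ≤ T) (j : ℕ)
    {t : ℝ} {z : E} {t' : ℝ} {z' : E} (ht : t ∈ Ioo (s' - (ρ / 8 ^ j) ^ 2 / 4) s')
    (hz : z ∈ ball x (ρ / 8 ^ j)) (ht' : t' ∈ Ioo (s' - (ρ / 8 ^ j) ^ 2 / 4) s')
    (hz' : z' ∈ ball x (ρ / 8 ^ j)) :
    w t z - w t' z' ≤ (1 - 1 / C) ^ j * (M - m) := by
  have hθ0 : 0 ≤ 1 - 1 / C := by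
    have : 1 / C ≤ 1 := by rw [div_le_one (by linarith)]; exact hC1
    linarith
  have hs4 : ρ ^ 2 < 4 * s' := by nlinarith
  induction j generalizing t z t' z' with
  | zero =>
    simp only [pow_zero, div_one] at ht hz ht' hz' ⊢
    obtain ⟨htm, hzm⟩ := topRegion_mem hB hs4 hsT ht hz
    obtain ⟨htm', hzm'⟩ := topRegion_mem hB hs4 hsT ht' hz'
    rw [one_mul]
    linarith [(hbd t htm z hzm).2, (hbd t' htm' z' hzm').1]
  | succ j ih =>
    -- the region at level `j` contains `Q((x,s'), 4r)`, `r = ρ/8ʲ⁺¹`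
    set ρj : ℝ := ρ / 8 ^ j with hρj
    set r : ℝ := ρ / 8 ^ (j + 1) with hr
    have hρj_eq : ρj = 8 * r := by
      simp only [hρj, hr, pow_succ]; field_simp
    have hrpos : 0 < r := by positivity
    have hρjpos : 0 < ρj := by positivity
    have hρj_le : ρj ≤ ρ := by
      rw [hρj, div_le_iff₀ (by positivity)]
      have : (1 : ℝ) ≤ 8 ^ j := one_le_pow₀ (by norm_num)
      nlinarith
    have hr_le : r ≤ R₀ := by
      have : r ≤ ρj := by rw [hρj_eq]; linarith
      exact this.trans (hρj_le.trans hρR₀)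
    have hBr : closedBall x (4 * r) ⊆ Ω := by
      refine (closedBall_subset_closedBall ?_).trans hB
      rw [hρj_eq] at hρj_le; linarith
    have h16 : 16 * r ^ 2 = ρj ^ 2 / 4 := by rw [hρj_eq]; ring
    have hρj2 : ρj ^ 2 ≤ ρ ^ 2 := pow_le_pow_left₀ hρjpos.le hρj_le 2
    have hsr : 16 * r ^ 2 < s' := by rw [h16]; nlinarith
    -- the values of `w` on the level-`j` region and their extrema
    set V : Set ℝ := (fun p : ℝ × E => w p.1 p.2) '' (Ioo (s' - ρj ^ 2 / 4) s' ×ˢ ball x ρj) with hV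
    have hVmem : ∀ {q : ℝ} {ζ : E}, q ∈ Ioo (s' - ρj ^ 2 / 4) s' → ζ ∈ ball x ρj → w q ζ ∈ V :=
      fun hq hζ => mem_image_of_mem (fun p : ℝ × E => w p.1 p.2) (mk_mem_prod hq hζ)
    have hVne : V.Nonempty := by
      have hq : s' - ρj ^ 2 / 8 ∈ Ioo (s' - ρj ^ 2 / 4) s' := by
        have : 0 < ρj ^ 2 := by positivity
        constructor <;> linarith
      exact ⟨_, hVmem hq (mem_ball_self hρjpos)⟩
    have hBj : closedBall x ρj ⊆ Ω := (closedBall_subset_closedBall hρj_le).trans hB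
    have hsj : ρj ^ 2 < 4 * s' := by nlinarith
    have hVabove : BddAbove V := by
      refine ⟨M, ?_⟩
      rintro _ ⟨⟨q, ζ⟩, ⟨hq, hζ⟩, rfl⟩
      obtain ⟨hqm, hζm⟩ := topRegion_mem hBj hsj hsT hq hζ
      exact (hbd q hqm ζ hζm).2
    have hVbelow : BddBelow V := by
      refine ⟨m, ?_⟩
      rintro _ ⟨⟨q, ζ⟩, ⟨hq, hζ⟩, rfl⟩
      obtain ⟨hqm, hζm⟩ := topRegion_mem hBj hsj hsT hq hζ
      exact (hbd q hqm ζ hζm).1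
    set M₄ := sSup V with hM₄
    set m₄ := sInf V with hm₄
    have hdiff : M₄ - m₄ ≤ (1 - 1 / C) ^ j * (M - m) := by
      have h1 : ∀ v ∈ V, v ≤ m₄ + (1 - 1 / C) ^ j * (M - m) := by
        rintro _ ⟨⟨q, ζ⟩, ⟨hq, hζ⟩, rfl⟩
        have h2 : w q ζ - (1 - 1 / C) ^ j * (M - m) ≤ m₄ := by
          refine le_csInf hVne ?_
          rintro _ ⟨⟨q', ζ'⟩, ⟨hq', hζ'⟩, rfl⟩
          have := ih hq hζ hq' hζ'
          simp only at this ⊢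
          linarith
        simp only
        linarith
      have := csSup_le hVne h1
      linarith
    -- bounds on `Q((x,s'), 4r) ⊆` level-`j` region, and the one-step decay
    have hbd4 : ∀ q ∈ Ioo (s' - 16 * r ^ 2) s', ∀ ζ ∈ ball x (4 * r), m₄ ≤ w q ζ ∧ w q ζ ≤ M₄ := by
      intro q hq ζ hζ
      rw [h16] at hq
      have hζ' : ζ ∈ ball x ρj := ball_subset_ball (by rw [hρj_eq]; linarith) hζ
      exact ⟨csInf_le hVbelow (hVmem hq hζ'), le_csSup hVabove (hVmem hq hζ')⟩
    have hstep := hC.osc_step hC1 hΩ hw hrpos hr_le hBr hsr hsT hbd4 ht hz ht' hz'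
    calc w t z - w t' z' ≤ (1 - 1 / C) * (M₄ - m₄) := hstep
      _ ≤ (1 - 1 / C) * ((1 - 1 / C) ^ j * (M - m)) := mul_le_mul_of_nonneg_left hdiff hθ0
      _ = (1 - 1 / C) ^ (j + 1) * (M - m) := by rw [pow_succ]; ring

/-! ### Harnack chains -/

/-- **Harnack chain** (Lieberman 1996, Ch. II proof of Theorem 2.7, invoked in Ch. VI
Theorem 6.25, "the chaining argument"): for a nonnegative solution on `(0,T] × Ω`, points
`Z₀, …, Zₙ` with `|Zᵢ₊₁ − Zᵢ| < R` and `B̄(Zᵢ, 4R) ⊆ Ω`, and increasing times `σ₀, …, σₙ` with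
lags `σᵢ₊₁ − σᵢ ≥ γR²` such that each consecutive pair lies in the top slab `(sᵢ − R², sᵢ)` of a
cylinder topped at some `sᵢ ≤ T`, `16R² < sᵢ`, one has `w(σ₀, Z₀) ≤ Cⁿ w(σₙ, Zₙ)`. [cite: Lieberman1996, Ch. II proof of Thm 2.7 (chaining), Ch. VI Thm 6.25] -/
theorem IsTwoPointHarnackConst.chain (hC : IsTwoPointHarnackConst E A R₀ γ C) (hC0 : 0 ≤ C)
    (hΩ : IsOpen Ω) (hw : IsDriftHeatSolutionOn a w A (Ioc 0 T) Ω)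
    (hw0 : ∀ t ∈ Ioc 0 T, ∀ z ∈ Ω, 0 ≤ w t z) {R : ℝ} (hR : 0 < R) (hRR₀ : R ≤ R₀)
    (Z : ℕ → E) (σ : ℕ → ℝ) (n : ℕ) (hZ : ∀ i < n, dist (Z (i + 1)) (Z i) < R)
    (hZΩ : ∀ i < n, closedBall (Z i) (4 * R) ⊆ Ω)
    (hlag : ∀ i < n, γ * R ^ 2 ≤ σ (i + 1) - σ i)
    (htop : ∀ i < n, ∃ s : ℝ, 16 * R ^ 2 < s ∧ s ≤ T ∧
      σ i ∈ Ioo (s - R ^ 2) s ∧ σ (i + 1) ∈ Ioo (s - R ^ 2) s) :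
    w (σ 0) (Z 0) ≤ C ^ n * w (σ n) (Z n) := by
  induction n with
  | zero => simp
  | succ n ih =>
    have h1 := ih (fun i hi => hZ i (by omega)) (fun i hi => hZΩ i (by omega))
      (fun i hi => hlag i (by omega)) (fun i hi => htop i (by omega))
    obtain ⟨s, hs, hsT, hσ, hσ'⟩ := htop n (by omega)
    have hpos : ∀ t ∈ Ioo (s - 16 * R ^ 2) s, ∀ z ∈ ball (Z n) (4 * R), 0 ≤ w t z := by
      intro t ht z hz
      exact hw0 t ⟨by linarith [ht.1], ht.2.le.trans hsT⟩ z ((hZΩ n (by omega)) (ball_subset_closedBall hz))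
    have h2 := hC.apply hΩ hw hR hRR₀ (hZΩ n (by omega)) hs hsT hpos hσ (mem_ball_self hR) hσ'
      (hZ n (by omega)) (hlag n (by omega))
    calc w (σ 0) (Z 0) ≤ C ^ n * w (σ n) (Z n) := h1
      _ ≤ C ^ n * (C * w (σ (n + 1)) (Z (n + 1))) := mul_le_mul_of_nonneg_left h2 (pow_nonneg hC0 n)
      _ = C ^ (n + 1) * w (σ (n + 1)) (Z (n + 1)) := by rw [pow_succ]; ring

end Consequences

end Literature.Analysis.FluidPDE

end
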